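import Literature.NumberTheory.Automorphic.AutomorphicFormsL2OrbitalSmoothingU21
import HarnessLib

/-!
# Orbital smoothing along the orbits of ANY locally compact group `S → G(𝔸)` through ANY continuous chart `e : E → S` with
# `e (-b) = (e b)⁻¹` — the chart-generic form of ★ `AutomorphicFormsL2OrbitalSmoothingU21`

Topic `NumberTheory/Automorphic`; namespace `Literature.NumberTheory.Automorphic` (sub-namespace `OrbitalSmoothingChart` for the probe calculus,
dot-notation extensions of `AdelicGroupData` for §3–§4, names = the ★ U21 names with `expP ↦ chart`).  Everything is PROVED; no definition,
no instance, no named fact, no `sorry`.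

★ `AutomorphicFormsL2OrbitalSmoothingU21` is the `U = U(2,1)`, `e = BallForms.expP : ℂ² → U(2,1)` layer over the generic ★
`AutomorphicFormsL2OrbitalSmoothing`; its proofs use exactly two facts about the chart: CONTINUITY of `e` and the one-parameter law
`e (-b) = (e b)⁻¹`.  This file is the same layer for ANY topological group `S` (Borel, second countable, locally compact, Hausdorff, with a
left Haar measure `ν` and a homomorphism `ι : S →* G(𝔸_K)`) and ANY chart `e : E → S` on a finite-dimensional (proper) real normed space with
those two properties as HYPOTHESES `(he : Continuous e) (he_neg : ∀ b, e (-b) = (e b)⁻¹)` — e.g. `S = U(σ_{w}H)(ℂ) ≤ GL₂(ℂ)` (★ `archLocal`),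
`E = ℂ`, `e z = exp (X z)` for a real-linear `X : ℂ → 𝔲(σ_w H)` (`NormedSpace.exp_neg`; the rank-2 probe of the P5 sub-line TP₂), or any
`exp`-chart of a linear real group.  The regularity of a scalar kernel `α : S → ℂ` is expressed as in the Lines bundles `IsRegularKernel(₁)`:
`∀ u, ContDiff ℝ 1 (b ↦ α (e b * u))` and joint continuity of `(b, u) ↦ D_b α(e b · u)`.

* §2 probe calculus along the RIGHT-hand probes `b ↦ α((e b)⁻¹ u)` (the ones the orbit formula produces): `hasFDerivAt_comp_chart_inv_mul(')`,
  `fderiv_comp_chart_inv_mul`, `continuous_fderiv_comp_chart_inv_mul`, `fderiv_comp_chart_inv_mul_eq_zero`,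
  `hasCompactSupport_fderiv_comp_chart_inv_mul(_apply)`, `continuous_fderiv_comp_chart_inv_mul_apply` (the operator-norm trivia
  `continuous_smulRight_complex` ∕ `norm_smulRight_complex_le` are ★ and reused by name);
* §3 POINTWISE: `hasFDerivAt_orbitalIntegral_chart`, `fderiv_orbitalIntegral_chart_apply`, `differentiableAt_orbitalIntegral_chart` — the orbital
  integral `Ψ(x) = ∫ α(u) φ(x ι(u)) dν(u)` is differentiable along `b ↦ Ψ(x ι(e b))` at every good base point, with derivative the orbital integral of
  the SAME `F` against the probe-derivative kernel;
* §4 IN `L²`: `rightRegular_integral_smul_rightRegular` (translating a smoothed class = smoothing with the translated weight),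
  `hasFDerivAt_integral_smul_rightRegular_chart` (dominated differentiation under the Bochner integral), `hasFDerivAt_rightRegular_chart_integral_smul`,
  `fderiv_rightRegular_chart_integral_smul_apply` (the `𝔭`-orbit map of a smoothed class is differentiable at `0`, its derivative in a direction is
  again a smoothed class).

Written for the P5 K-lane sub-line TP₂ (`Cruxes/HLiu418/Lines/F0_P5TP2SpectralProjection.lean`, stubs (R₂)∕(S₂); A-p04 (g21) consumes it in
`Theorems/F0P5TP2StubR2Engine`∕`…StubR2`), cell hodgecm-mathlib.  HC_CM is proved only modulo the 7 printed citations until rung 0 closes.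

## References
* [HarishChandraTAMS1953] Harish-Chandra, Trans. AMS 75 (1953), §9 (differentiating `∫ α(u) π(u) v du` along one-parameter groups).
* [Borel1997] A. Borel, *Automorphic forms on SL₂(ℝ)* (1997), Thm. 2.13–2.14, §5.14.
* [BorelJacquetCorvallis1979] A. Borel, H. Jacquet, PSPM 33.1 (1979), §4.6.  [Folland1995] G. B. Folland (1995), §2.5, §3.2.
-/

open scoped Topology ContDiff Pointwise
open Set Function Filter
open _root_.MeasureTheory _root_.MeasureTheory.Measure

noncomputable section

namespace Literature.NumberTheory.Automorphic

namespace OrbitalSmoothingChart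

open OrbitalSmoothingU21 (continuous_smulRight_complex norm_smulRight_complex_le)

/-! ### 2. Probe calculus of a scalar kernel that is `C¹` along the left `e`-probes -/

variable {S : Type*} [Group S] [TopologicalSpace S] [IsTopologicalGroup S]
  {E : Type*} [NormedAddCommGroup E] [NormedSpace ℝ E]
  {e : E → S} {α : S → ℂ}

omit [TopologicalSpace S] [IsTopologicalGroup S] [NormedSpace ℝ E] in
/-- The right-hand probe `b ↦ α((e b)⁻¹ u)` is the left-hand probe `b ↦ α(e b · u)` precomposed with `b ↦ -b`. [cite: Borel1997, §5.14] -/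
theorem comp_chart_inv_mul_eq (he_neg : ∀ b, e (-b) = (e b)⁻¹) (u : S) :
    (fun b : E ↦ α ((e b)⁻¹ * u)) = (fun b : E ↦ α (e b * u)) ∘ fun b ↦ -b := by
  funext b
  simp only [comp_apply, he_neg]

omit [TopologicalSpace S] [IsTopologicalGroup S] in
/-- **Differentiability of the right-hand probe**: if `b ↦ α(e b · u)` is `C¹` then `b ↦ α((e b)⁻¹ u)` has the Fréchet derivative
`-(D_b α(e b · u))|_{-b}` at `b`. [cite: Borel1997, §2.13 and §5.14] -/
theorem hasFDerivAt_comp_chart_inv_mul (he_neg : ∀ b, e (-b) = (e b)⁻¹) (hdiff : ∀ u : S, ContDiff ℝ 1 fun b : E ↦ α (e b * u))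
    (b : E) (u : S) :
    HasFDerivAt (fun b' : E ↦ α ((e b')⁻¹ * u)) (-(fderiv ℝ (fun b' : E ↦ α (e b' * u)) (-b))) b := by
  have hg : HasFDerivAt (fun b' : E ↦ α (e b' * u)) (fderiv ℝ (fun b' : E ↦ α (e b' * u)) (-b)) (-b) :=
    (((hdiff u).differentiable one_ne_zero) (-b)).hasFDerivAt
  have hneg : HasFDerivAt (fun b' : E ↦ -b') (-(ContinuousLinearMap.id ℝ E)) b := (hasFDerivAt_id b).neg
  have h := hg.comp b hneg
  rw [comp_chart_inv_mul_eq he_neg]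
  refine h.congr_fderiv ?_
  rw [ContinuousLinearMap.comp_neg, ContinuousLinearMap.comp_id]

omit [TopologicalSpace S] [IsTopologicalGroup S] in
/-- The derivative token: `fderiv ℝ (b' ↦ α((e b')⁻¹ u)) b = -(fderiv ℝ (b' ↦ α(e b' · u)) (-b))`. [cite: Borel1997, §2.13] -/
theorem fderiv_comp_chart_inv_mul (he_neg : ∀ b, e (-b) = (e b)⁻¹) (hdiff : ∀ u : S, ContDiff ℝ 1 fun b : E ↦ α (e b * u))
    (b : E) (u : S) :
    fderiv ℝ (fun b' : E ↦ α ((e b')⁻¹ * u)) b = -(fderiv ℝ (fun b' : E ↦ α (e b' * u)) (-b)) :=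
  (hasFDerivAt_comp_chart_inv_mul he_neg hdiff b u).fderiv

omit [TopologicalSpace S] [IsTopologicalGroup S] in
/-- The right-hand probe is differentiable, with derivative its own `fderiv` (the form consumed by
★ `hasFDerivAt_orbitalIntegral_mul_hom`). [cite: Borel1997, §2.13] -/
theorem hasFDerivAt_comp_chart_inv_mul' (he_neg : ∀ b, e (-b) = (e b)⁻¹) (hdiff : ∀ u : S, ContDiff ℝ 1 fun b : E ↦ α (e b * u))
    (b : E) (u : S) :
    HasFDerivAt (fun b' : E ↦ α ((e b')⁻¹ * u)) (fderiv ℝ (fun b' : E ↦ α ((e b')⁻¹ * u)) b) b := by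
  rw [fderiv_comp_chart_inv_mul he_neg hdiff]
  exact hasFDerivAt_comp_chart_inv_mul he_neg hdiff b u

omit [IsTopologicalGroup S] in
/-- **Joint continuity of the right-hand probe derivative** `(b, u) ↦ fderiv ℝ (b' ↦ α((e b')⁻¹ u)) b`, from that of the left-hand one.
[cite: Borel1997, §2.13] -/
theorem continuous_fderiv_comp_chart_inv_mul (he_neg : ∀ b, e (-b) = (e b)⁻¹)
    (hdiff : ∀ u : S, ContDiff ℝ 1 fun b : E ↦ α (e b * u))
    (hcontD : Continuous fun p : E × S ↦ fderiv ℝ (fun b : E ↦ α (e b * p.2)) p.1) :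
    Continuous fun p : E × S ↦ fderiv ℝ (fun b' : E ↦ α ((e b')⁻¹ * p.2)) p.1 := by
  have h : Continuous fun p : E × S ↦ -(fderiv ℝ (fun b : E ↦ α (e b * p.2)) (-p.1)) :=
    (hcontD.comp (continuous_fst.neg.prodMk continuous_snd)).neg
  refine h.congr fun p ↦ ?_
  rw [fderiv_comp_chart_inv_mul he_neg hdiff]

omit [IsTopologicalGroup S] in
/-- **The probe derivative is compactly supported in `u`** (locally uniformly in `b`): for `u` outside `e(closedBall(b, 1)) · tsupport α` the
probe `b' ↦ α((e b')⁻¹ u)` vanishes near `b`, so its derivative at `b` is `0`. [cite: Borel1997, §2.13] -/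
theorem fderiv_comp_chart_inv_mul_eq_zero (b : E) {u : S} (hu : u ∉ e '' Metric.closedBall b 1 * tsupport α) :
    fderiv ℝ (fun b' : E ↦ α ((e b')⁻¹ * u)) b = 0 := by
  have hloc : (fun b' : E ↦ α ((e b')⁻¹ * u)) =ᶠ[𝓝 b] fun _ ↦ (0 : ℂ) := by
    filter_upwards [Metric.isOpen_ball.mem_nhds (Metric.mem_ball_self zero_lt_one)] with b' hb'
    by_contra hne
    exact hu ⟨e b', mem_image_of_mem _ (Metric.ball_subset_closedBall hb'), (e b')⁻¹ * u,
      subset_tsupport _ (mem_support.2 hne), mul_inv_cancel_left _ _⟩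
  rw [hloc.fderiv_eq, fderiv_const_apply]

/-- The support bound as a `HasCompactSupport` statement (`e` continuous, closed balls of the proper space `E` compact).
[cite: Borel1997, §2.13] -/
theorem hasCompactSupport_fderiv_comp_chart_inv_mul [ProperSpace E] (he : Continuous e) (hsupp : HasCompactSupport α) (b : E) :
    HasCompactSupport fun u : S ↦ fderiv ℝ (fun b' : E ↦ α ((e b')⁻¹ * u)) b := by
  refine HasCompactSupport.of_support_subset_isCompact (((isCompact_closedBall b 1).image he).mul hsupp) fun u hu ↦ ?_
  by_contra hnot
  exact hu (fderiv_comp_chart_inv_mul_eq_zero b hnot)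

omit [IsTopologicalGroup S] in
/-- For each direction `v`, the evaluated probe derivative `u ↦ D_b|_{b₀} α((e b)⁻¹ u) · v` is a continuous scalar weight on `S`
(the derivative KERNEL in direction `v`). [cite: Borel1997, §2.13] -/
theorem continuous_fderiv_comp_chart_inv_mul_apply (he_neg : ∀ b, e (-b) = (e b)⁻¹)
    (hdiff : ∀ u : S, ContDiff ℝ 1 fun b : E ↦ α (e b * u))
    (hcontD : Continuous fun p : E × S ↦ fderiv ℝ (fun b : E ↦ α (e b * p.2)) p.1) (b₀ v : E) :
    Continuous fun u : S ↦ fderiv ℝ (fun b' : E ↦ α ((e b')⁻¹ * u)) b₀ v :=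
  ((ContinuousLinearMap.apply ℝ ℂ v).continuous.comp
    ((continuous_fderiv_comp_chart_inv_mul he_neg hdiff hcontD).comp (Continuous.prodMk_right b₀)))

/-- Compact support of the derivative kernel in direction `v`. [cite: Borel1997, §2.13] -/
theorem hasCompactSupport_fderiv_comp_chart_inv_mul_apply [ProperSpace E] (he : Continuous e) (hsupp : HasCompactSupport α) (b₀ v : E) :
    HasCompactSupport fun u : S ↦ fderiv ℝ (fun b' : E ↦ α ((e b')⁻¹ * u)) b₀ v :=
  (hasCompactSupport_fderiv_comp_chart_inv_mul he hsupp b₀).mono fun u hu ↦ by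
    intro h0
    refine hu ?_
    show fderiv ℝ (fun b' : E ↦ α ((e b')⁻¹ * u)) b₀ v = 0
    rw [show fderiv ℝ (fun b' : E ↦ α ((e b')⁻¹ * u)) b₀ = 0 from h0, _root_.zero_apply]

end OrbitalSmoothingChart

/-! ### 3. The orbital integral along `S`-orbits: pointwise probe derivatives through the chart -/

namespace AdelicGroupData

open OrbitalSmoothingChart
open OrbitalSmoothingU21 (continuous_smulRight_complex norm_smulRight_complex_le)

section Pointwise

variable {K : Type} [Field K] [NumberField K] (𝒢 : AdelicGroupData K)
  {S : Type*} [Group S] [TopologicalSpace S] [IsTopologicalGroup S] [MeasurableSpace S] [BorelSpace S]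
  [SecondCountableTopology S] [LocallyCompactSpace S] [T2Space S] (ν : Measure S) [ν.IsHaarMeasure]
  {E : Type*} [NormedAddCommGroup E] [NormedSpace ℝ E] [ProperSpace E] {e : E → S}
  {ι : S →* 𝒢.Adelic} {α : S → ℂ}

/-- **The orbital integral with a probe-`C¹` kernel is differentiable along every `e`-probe at every good base point**, with
derivative the orbital integral of the SAME class against the probe derivative of the kernel: for `α` continuous, compactly supported, `C¹`
along the left `e`-probes with jointly continuous probe derivative, and `F` with locally integrable orbit function at `x`,
`D_b|_{b₀} Ψ(x ι(e b)) = ∫ φ(x ι(u)) • D_b|_{b₀} α((e b)⁻¹ u) dν(u)` (`φ = invQuot F`). [cite: HarishChandraTAMS1953, §9] [cite: Borel1997, Thm. 2.13] -/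
theorem hasFDerivAt_orbitalIntegral_chart (he : Continuous e) (he_neg : ∀ b, e (-b) = (e b)⁻¹) (hαc : Continuous α)
    (hsupp : HasCompactSupport α) (hdiff : ∀ u : S, ContDiff ℝ 1 fun b : E ↦ α (e b * u))
    (hcontD : Continuous fun p : E × S ↦ fderiv ℝ (fun b : E ↦ α (e b * p.2)) p.1)
    (F : 𝒢.automorphicQuotient → ℂ) {x : 𝒢.Adelic} (hx : LocallyIntegrable (fun u ↦ invQuot 𝒢 F (x * ι u)) ν) (b₀ : E) :
    HasFDerivAt (fun b : E ↦ ∫ u, α u * invQuot 𝒢 F (x * ι (e b) * ι u) ∂ν)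
      (∫ u, invQuot 𝒢 F (x * ι u) • fderiv ℝ (fun b' : E ↦ α ((e b')⁻¹ * u)) b₀ ∂ν) b₀ :=
  𝒢.hasFDerivAt_orbitalIntegral_mul_hom ν hαc hsupp he isOpen_univ (mem_univ b₀)
    (D := fun p : E × S ↦ fderiv ℝ (fun b' : E ↦ α ((e b')⁻¹ * p.2)) p.1)
    (continuous_fderiv_comp_chart_inv_mul he_neg hdiff hcontD) (fun b _ u ↦ hasFDerivAt_comp_chart_inv_mul' he_neg hdiff b u) F hx

/-- **The probe derivative of the orbital integral, evaluated**: in the direction `v`,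
`D_b|_{b₀} Ψ(x ι(e b)) · v = ∫ (D_b|_{b₀} α((e b)⁻¹ u) · v) φ(x ι(u)) dν(u)`. [cite: HarishChandraTAMS1953, §9] [cite: Borel1997, Thm. 2.13] -/
theorem fderiv_orbitalIntegral_chart_apply (he : Continuous e) (he_neg : ∀ b, e (-b) = (e b)⁻¹) (hαc : Continuous α)
    (hsupp : HasCompactSupport α) (hdiff : ∀ u : S, ContDiff ℝ 1 fun b : E ↦ α (e b * u))
    (hcontD : Continuous fun p : E × S ↦ fderiv ℝ (fun b : E ↦ α (e b * p.2)) p.1)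
    (F : 𝒢.automorphicQuotient → ℂ) {x : 𝒢.Adelic} (hx : LocallyIntegrable (fun u ↦ invQuot 𝒢 F (x * ι u)) ν) (b₀ v : E) :
    fderiv ℝ (fun b : E ↦ ∫ u, α u * invQuot 𝒢 F (x * ι (e b) * ι u) ∂ν) b₀ v =
      ∫ u, fderiv ℝ (fun b' : E ↦ α ((e b')⁻¹ * u)) b₀ v * invQuot 𝒢 F (x * ι u) ∂ν := by
  rw [(𝒢.hasFDerivAt_orbitalIntegral_chart ν he he_neg hαc hsupp hdiff hcontD F hx b₀).fderiv]
  have hint : Integrable (fun u ↦ invQuot 𝒢 F (x * ι u) • fderiv ℝ (fun b' : E ↦ α ((e b')⁻¹ * u)) b₀) ν :=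
    hx.integrable_smul_right_of_hasCompactSupport
      ((continuous_fderiv_comp_chart_inv_mul he_neg hdiff hcontD).comp (Continuous.prodMk_right b₀))
      (hasCompactSupport_fderiv_comp_chart_inv_mul he hsupp b₀)
  rw [ContinuousLinearMap.integral_apply hint v]
  refine congrArg (fun f : S → ℂ ↦ ∫ u, f u ∂ν) (funext fun u ↦ ?_)
  rw [_root_.smul_apply, smul_eq_mul, mul_comm]

/-- The probe of the orbital integral is differentiable at every `b₀` (the `DifferentiableAt` form of `hasFDerivAt_orbitalIntegral_chart`).
[cite: Borel1997, Thm. 2.13] -/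
theorem differentiableAt_orbitalIntegral_chart (he : Continuous e) (he_neg : ∀ b, e (-b) = (e b)⁻¹) (hαc : Continuous α)
    (hsupp : HasCompactSupport α) (hdiff : ∀ u : S, ContDiff ℝ 1 fun b : E ↦ α (e b * u))
    (hcontD : Continuous fun p : E × S ↦ fderiv ℝ (fun b : E ↦ α (e b * p.2)) p.1)
    (F : 𝒢.automorphicQuotient → ℂ) {x : 𝒢.Adelic} (hx : LocallyIntegrable (fun u ↦ invQuot 𝒢 F (x * ι u)) ν) (b₀ : E) :
    DifferentiableAt ℝ (fun b : E ↦ ∫ u, α u * invQuot 𝒢 F (x * ι (e b) * ι u) ∂ν) b₀ :=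
  (𝒢.hasFDerivAt_orbitalIntegral_chart ν he he_neg hαc hsupp hdiff hcontD F hx b₀).differentiableAt

end Pointwise

/-! ### 4. The `L²` side: the `𝔭`-orbit map of a smoothed class is differentiable, with derivative a smoothed class -/

section L2Side

variable {K : Type} [Field K] [NumberField K] (𝒢 : AdelicGroupData K)
  (μ : Measure 𝒢.automorphicQuotient) [𝒢.IsAutomorphicMeasure μ]
  {S : Type*} [Group S] [TopologicalSpace S] [IsTopologicalGroup S] [MeasurableSpace S] [BorelSpace S]
  [SecondCountableTopology S] [LocallyCompactSpace S] [T2Space S] (ν : Measure S) [ν.IsHaarMeasure]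
  {E : Type*} [NormedAddCommGroup E] [NormedSpace ℝ E] [ProperSpace E] {e : E → S}
  {ι : S →* 𝒢.Adelic} {α : S → ℂ}

omit [IsTopologicalGroup S] [SecondCountableTopology S] [LocallyCompactSpace S] [T2Space S] in
/-- The `L²`-valued integrand `u ↦ α(u) • R(ι u) v` of the smoothing operator is integrable for `α` continuous with compact support
(strong continuity of `R`, `‖R(ι u) v‖ = ‖v‖`). [cite: BorelJacquetCorvallis1979, §4.6] -/
theorem integrable_smul_rightRegular_of_hasCompactSupport' (hι : Continuous ι) (hαc : Continuous α) (hsupp : HasCompactSupport α)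
    (v : 𝒢.L2 μ) :
    Integrable (fun u : S ↦ α u • 𝒢.rightRegular μ (ι u) v) ν := by
  have hc : Continuous fun u : S ↦ 𝒢.rightRegular μ (ι u) v := (𝒢.isStronglyContinuous_rightRegular_holds μ v).comp hι
  exact ((hαc.smul hc).integrable_of_hasCompactSupport (hsupp.smul_right))

omit [SecondCountableTopology S] [LocallyCompactSpace S] [T2Space S] in
/-- **Translating a smoothed class is smoothing with the translated weight**: `R(ι g) (∫ α(u) R(ι u) v dν(u)) = ∫ α(g⁻¹ u) R(ι u) v dν(u)`
(`R(ι g)` is continuous linear and multiplicative in `g`; left invariance of `ν`). [cite: BorelJacquetCorvallis1979, §4.6] [cite: Folland1995, §3.2] -/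
theorem rightRegular_integral_smul_rightRegular' (hι : Continuous ι) (hαc : Continuous α) (hsupp : HasCompactSupport α) (v : 𝒢.L2 μ)
    (g : S) :
    𝒢.rightRegular μ (ι g) (∫ u, α u • 𝒢.rightRegular μ (ι u) v ∂ν) = ∫ u, α (g⁻¹ * u) • 𝒢.rightRegular μ (ι u) v ∂ν := by
  rw [← ContinuousLinearMap.integral_comp_comm _ (𝒢.integrable_smul_rightRegular_of_hasCompactSupport' μ ν hι hαc hsupp v)]
  have h := integral_mul_left_eq_self (μ := ν) (fun u ↦ α (g⁻¹ * u) • 𝒢.rightRegular μ (ι u) v) g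
  simp only [inv_mul_cancel_left] at h
  rw [← h]
  refine congrArg (fun f : S → 𝒢.L2 μ ↦ ∫ u, f u ∂ν) (funext fun u ↦ ?_)
  rw [ContinuousLinearMap.map_smul, map_mul ι, map_mul (𝒢.rightRegular μ)]
  rfl

/-- **Differentiation under the `L²`-valued integral**: for `α` continuous, compactly supported and `C¹` along the left `e`-probes with
jointly continuous probe derivative, `b ↦ ∫ α((e b)⁻¹ u) • R(ι u) v dν(u)` has, at every `b₀`, the Fréchet derivative
`∫ (D_b|_{b₀} α((e b)⁻¹ u)) ⊗ R(ι u) v dν(u)` (dominated differentiation, the integrands living on the compact `e(B̄(b₀,1)) · tsupport α`).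
[cite: HarishChandraTAMS1953, §9] [cite: Folland1995, §3.2] -/
theorem hasFDerivAt_integral_smul_rightRegular_chart (he : Continuous e) (he_neg : ∀ b, e (-b) = (e b)⁻¹) (hι : Continuous ι)
    (hαc : Continuous α) (hsupp : HasCompactSupport α) (hdiff : ∀ u : S, ContDiff ℝ 1 fun b : E ↦ α (e b * u))
    (hcontD : Continuous fun p : E × S ↦ fderiv ℝ (fun b : E ↦ α (e b * p.2)) p.1) (v : 𝒢.L2 μ) (b₀ : E) :
    HasFDerivAt (fun b : E ↦ ∫ u, α ((e b)⁻¹ * u) • 𝒢.rightRegular μ (ι u) v ∂ν)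
      (∫ u, (fderiv ℝ (fun b' : E ↦ α ((e b')⁻¹ * u)) b₀).smulRight (𝒢.rightRegular μ (ι u) v) ∂ν) b₀ := by
  -- notation
  set R : S → 𝒢.L2 μ := fun u ↦ 𝒢.rightRegular μ (ι u) v with hR
  have hRc : Continuous R := (𝒢.isStronglyContinuous_rightRegular_holds μ v).comp hι
  have hRn : ∀ u, ‖R u‖ = ‖v‖ := fun u ↦ 𝒢.norm_rightRegular_apply μ (ι u) v
  set D : E × S → (E →L[ℝ] ℂ) := fun p ↦ fderiv ℝ (fun b' : E ↦ α ((e b')⁻¹ * p.2)) p.1 with hD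
  have hDc : Continuous D := continuous_fderiv_comp_chart_inv_mul he_neg hdiff hcontD
  -- the compact set carrying all integrands for `b ∈ closedBall b₀ 1`
  set B : Set E := Metric.closedBall b₀ 1 with hB
  have hBc : IsCompact B := isCompact_closedBall _ _
  set C : Set S := e '' B * tsupport α with hC
  have hCc : IsCompact C := (hBc.image he).mul hsupp
  have hzero : ∀ b ∈ B, ∀ u ∉ C, α ((e b)⁻¹ * u) = 0 := by
    intro b hb u hu
    by_contra hne
    exact hu ⟨e b, mem_image_of_mem _ hb, (e b)⁻¹ * u, subset_tsupport _ (mem_support.2 hne), mul_inv_cancel_left _ _⟩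
  have hDzero : ∀ b ∈ Metric.ball b₀ (1 / 2), ∀ u ∉ C, D (b, u) = 0 := by
    intro b hb u hu
    have hloc : (fun b' : E ↦ α ((e b')⁻¹ * u)) =ᶠ[𝓝 b] fun _ ↦ (0 : ℂ) := by
      filter_upwards [Metric.isOpen_ball.mem_nhds hb] with b' hb'
      refine hzero b' (Metric.ball_subset_closedBall ?_) u hu
      exact lt_of_lt_of_le (Metric.mem_ball.1 hb') (by norm_num)
    show fderiv ℝ (fun b' : E ↦ α ((e b')⁻¹ * u)) b = 0
    rw [hloc.fderiv_eq, fderiv_const_apply]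
  obtain ⟨M, hM⟩ := (hBc.prod hCc).exists_bound_of_continuousOn (f := D) hDc.continuousOn
  have hec : Continuous fun b : E ↦ (e b)⁻¹ := he.inv
  have hmeasF : ∀ b, AEStronglyMeasurable (fun u ↦ α ((e b)⁻¹ * u) • R u) ν := fun b ↦
    ((hαc.comp (continuous_const.mul continuous_id)).smul hRc).aestronglyMeasurable
  have hCfin : ν C < ⊤ := hCc.measure_lt_top
  have hint₀ : Integrable (fun u ↦ α ((e b₀)⁻¹ * u) • R u) ν := by
    have hs : HasCompactSupport (fun u ↦ α ((e b₀)⁻¹ * u) • R u) := by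
      refine HasCompactSupport.of_support_subset_isCompact hCc fun u hu ↦ ?_
      by_contra hnot
      exact hu (by simp only [hzero b₀ (Metric.mem_closedBall_self zero_le_one) u hnot, zero_smul])
    exact ((hαc.comp (continuous_const.mul continuous_id)).smul hRc).integrable_of_hasCompactSupport hs
  have hF'c : Continuous fun u ↦ (D (b₀, u)).smulRight (R u) :=
    continuous_smulRight_complex (hDc.comp (Continuous.prodMk_right b₀)) hRc
  have hhalf : (0 : ℝ) < 1 / 2 := by norm_num
  refine hasFDerivAt_integral_of_dominated_of_fderiv_le (F' := fun b u ↦ (D (b, u)).smulRight (R u))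
    (bound := C.indicator fun _ ↦ M * ‖v‖) (s := Metric.ball b₀ (1 / 2))
    (Metric.ball_mem_nhds b₀ hhalf) (Eventually.of_forall hmeasF) hint₀ hF'c.aestronglyMeasurable ?_ ?_ ?_
  · refine Eventually.of_forall fun u b hb ↦ ?_
    by_cases hu : u ∈ C
    · rw [indicator_of_mem hu]
      have hbB : b ∈ B := Metric.ball_subset_closedBall (lt_of_lt_of_le (Metric.mem_ball.1 hb) (by norm_num))
      calc ‖(D (b, u)).smulRight (R u)‖ ≤ ‖D (b, u)‖ * ‖R u‖ := norm_smulRight_complex_le _ _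
        _ ≤ M * ‖v‖ := by
          rw [hRn]
          exact mul_le_mul_of_nonneg_right (hM (b, u) ⟨hbB, hu⟩) (norm_nonneg _)
    · simp [indicator_of_notMem hu, hDzero b hb u hu]
  · rw [integrable_indicator_iff hCc.measurableSet]
    exact integrableOn_const hCfin.ne
  · exact Eventually.of_forall fun u b _ ↦ (hasFDerivAt_comp_chart_inv_mul' he_neg hdiff b u).smul_const (R u)

/-- **The `e`-orbit map of a smoothed class is differentiable at `0`**, with derivative the `CLM`-valued smoothing of the same class by the
probe-derivative kernel: for `w = ∫ α(u) R(ι u) v dν(u)`, `D_b|_0 R(ι(e b)) w = ∫ (D_b|_0 α((e b)⁻¹ u)) ⊗ R(ι u) v dν(u)`.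
[cite: HarishChandraTAMS1953, §9] [cite: Borel1997, Thm. 2.13] -/
theorem hasFDerivAt_rightRegular_chart_integral_smul (he : Continuous e) (he_neg : ∀ b, e (-b) = (e b)⁻¹) (hι : Continuous ι)
    (hαc : Continuous α) (hsupp : HasCompactSupport α) (hdiff : ∀ u : S, ContDiff ℝ 1 fun b : E ↦ α (e b * u))
    (hcontD : Continuous fun p : E × S ↦ fderiv ℝ (fun b : E ↦ α (e b * p.2)) p.1) (v : 𝒢.L2 μ) :
    HasFDerivAt (fun b : E ↦ 𝒢.rightRegular μ (ι (e b)) (∫ u, α u • 𝒢.rightRegular μ (ι u) v ∂ν))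
      (∫ u, (fderiv ℝ (fun b' : E ↦ α ((e b')⁻¹ * u)) 0).smulRight (𝒢.rightRegular μ (ι u) v) ∂ν) 0 := by
  have h := 𝒢.hasFDerivAt_integral_smul_rightRegular_chart μ ν he he_neg hι hαc hsupp hdiff hcontD v 0
  refine h.congr_of_eventuallyEq (Eventually.of_forall fun b ↦ ?_)
  exact 𝒢.rightRegular_integral_smul_rightRegular' μ ν hι hαc hsupp v (e b)

/-- **The derivative evaluated in a direction is again a smoothed class**:
`(D_b|_0 R(ι(e b)) w) · b = ∫ (D_b|_0 α((e b)⁻¹ u) · b) • R(ι u) v dν(u)` — the smoothing of `v` by the continuous compactly supported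
derivative kernel `u ↦ D(0,u) b` (so its pointwise representative is an orbital integral, ★ `coeFn_integral_smul_rightRegular_toLp_eq_orbitalIntegral`).
[cite: HarishChandraTAMS1953, §9] [cite: Borel1997, Thm. 2.13] -/
theorem fderiv_rightRegular_chart_integral_smul_apply (he : Continuous e) (he_neg : ∀ b, e (-b) = (e b)⁻¹) (hι : Continuous ι)
    (hαc : Continuous α) (hsupp : HasCompactSupport α) (hdiff : ∀ u : S, ContDiff ℝ 1 fun b : E ↦ α (e b * u))
    (hcontD : Continuous fun p : E × S ↦ fderiv ℝ (fun b : E ↦ α (e b * p.2)) p.1) (v : 𝒢.L2 μ) (b : E) :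
    fderiv ℝ (fun b' : E ↦ 𝒢.rightRegular μ (ι (e b')) (∫ u, α u • 𝒢.rightRegular μ (ι u) v ∂ν)) 0 b =
      ∫ u, fderiv ℝ (fun b' : E ↦ α ((e b')⁻¹ * u)) 0 b • 𝒢.rightRegular μ (ι u) v ∂ν := by
  rw [(𝒢.hasFDerivAt_rightRegular_chart_integral_smul μ ν he he_neg hι hαc hsupp hdiff hcontD v).fderiv]
  have hRc : Continuous fun u : S ↦ 𝒢.rightRegular μ (ι u) v := (𝒢.isStronglyContinuous_rightRegular_holds μ v).comp hι
  have hint : Integrable (fun u : S ↦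
      (fderiv ℝ (fun b' : E ↦ α ((e b')⁻¹ * u)) 0).smulRight (𝒢.rightRegular μ (ι u) v)) ν := by
    refine Continuous.integrable_of_hasCompactSupport ?_ ?_
    · exact continuous_smulRight_complex ((continuous_fderiv_comp_chart_inv_mul he_neg hdiff hcontD).comp (Continuous.prodMk_right 0)) hRc
    · refine (hasCompactSupport_fderiv_comp_chart_inv_mul he hsupp 0).mono fun u hu ↦ ?_
      intro h0
      refine hu ?_
      show (fderiv ℝ (fun b' : E ↦ α ((e b')⁻¹ * u)) 0).smulRight (𝒢.rightRegular μ (ι u) v) = 0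
      rw [show fderiv ℝ (fun b' : E ↦ α ((e b')⁻¹ * u)) 0 = 0 from h0]
      ext x
      simp
  rw [ContinuousLinearMap.integral_apply hint b]
  rfl

end L2Side

end AdelicGroupData

end Literature.NumberTheory.Automorphic
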